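import Literature.Computability.Cryptography.InaccessibleEntropyUOWHFInstance
import Literature.Computability.Cryptography.InaccessibleEntropyUOWHFInverterBricks
import Literature.Computability.Cryptography.UOWHFCombiners
import HarnessLib

/-!
# One-way functions ⇒ UOWHF, machine layer V: the final family and its adversaries in the combinatorial model

Topic `Literature/Computability/Cryptography`; thirteenth file of the "one-way functions ⇒ universal one-way
hash functions" line (Haitner–Holenstein–Reingold–Vadhan–Wee 2020, proof of Thm. 5.1). The combinatorial
combiners of `UOWHFCombiners.lean` (`concatFam`, `chainState`/`chainOut`, the planting reductions) and the
single-candidate analysis `CandData` (`InaccessibleEntropyUOWHF.lean`) are stated over abstract finite types;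
the string evaluator `evalStr` of `InaccessibleEntropyUOWHFFamily.lean` and a string-level two-stage
adversary `(A₀, A)` (a function and a `RandAlg`, as in Def. 6.4.19) live on `List Bool`. This file, at ONE
security parameter `n`, puts the latter in the former's terms through the codecs of `BitCodecs.lean`:

* `keysCodec`, `inCodec`, `pack`, `famO`: the keys `(Fin (J+1) → Fin (R+1) → 𝔽₂^N)`, the chain input
  `𝔽₂^N × (Fin R → Bool)`, the repacking `(G_y(st), c) ↦ st'` (injective, `pack_injective`), the basic family
  `G^{(j)}_y = (cand n j f).fam y`; `keyAt_enc`, `chainSt_enc`, `chainOutStr_enc`, `evalStr_enc` — the string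
  evaluator IS `concatFam (chainOut …)` on codes;
* `targetAbs`, `advAbs` — the abstract two-stage adversary of a string pair `(A₀, A)` at `n` (target coins
  `ρ ∈ {0,1}^{q}`, index coins `(keys, leftover) ≅ {0,1}^{p}`, adversary coins `ω ∈ {0,1}^{κ}`), and
  **`collision_abs_of_str`**: a restricted designated collision of the strings is a designated collision of the
  abstract concatenation with distinct points;
* the derived single-candidate adversary at grid index `j` and chain level `r` — `targetJR`, `advJR`
  (concatenation planting then level planting, literally the maps counted by `card_concat_success_mul_le` and
  `card_chain_success_mul_le`) — and **`rawA0`**, the check-free form of the finder `advA0` that the inverting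
  MACHINE computes, with `advA0_eq_or`: `advA0 … ∈ {x, rawA0 …}`.

All statements proved; no named facts, no machines.

## References

* I. Haitner, T. Holenstein, O. Reingold, S. Vadhan, H. Wee, *Inaccessible Entropy II: IE Functions and
  Universal One-Way Hashing*, Theory of Computing 16(8) (2020), proof of Thm. 5.1, Steps 4–5, Lemmas 5.3–5.7,
  Claim 4.6.
* O. Goldreich, *Foundations of Cryptography II*, CUP 2004, §6.4.3.2 (Def. 6.4.19, Prop. 6.4.23).
-/

namespace Literature.Computability.Cryptography

namespace HHRVW

open _root_.Computability Complexity Complexity.BitCodec AffineStr Sz Finset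

/-! ### One bit -/

/-- Booleans as one bit. [folklore] -/
def bitCodec : BitCodec Bool where
  len := 1
  enc b := [b]
  dec l := l.headD false
  length_enc _ := rfl
  dec_enc _ := rfl
  enc_dec l hl := by
    match l, hl with
    | [b], _ => rfl

/-- Bookkeeping lemma (record accessors, codec lengths). [folklore] -/
@[simp] theorem bitCodec_len : bitCodec.len = 1 := rfl
/-- Bookkeeping lemma (record accessors, codec lengths). [folklore] -/
@[simp] theorem bitCodec_enc (b : Bool) : bitCodec.enc b = [b] := rfl

/-! ### The final family in the combinatorial model -/

section Model

variable (f : List Bool → List Bool) (n : ℕ)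

/-- All keys: `(Fin (J+1) → Fin (R+1) → 𝔽₂^N)`, coded blockwise (`K` bits). [cite: HaitnerEtAl2020, proof of Thm. 5.1, Step 5] -/
def keysCodec : BitCodec (Fin (Jp1 n) → Fin (R n + 1) → Dv n) := ((zvec (N n)).pi (R n + 1)).pi (Jp1 n)

/-- `keysCodec` has `K` bits. [folklore] -/
theorem keysCodec_len : (keysCodec n).len = K n := by
  simp only [keysCodec, pi_len, zvec_len, K]; ring

/-- The chain input `(st₀, extension bits) ∈ 𝔽₂^N × (Fin R → Bool)`, coded as `N + R = d` bits.
[cite: HaitnerEtAl2020, Lemma 5.7] -/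
def inCodec : BitCodec (Dv n × (Fin (R n) → Bool)) := (zvec (N n)).prod (bitCodec.pi (R n))

/-- `inCodec` has `d` bits. [folklore] -/
theorem inCodec_len : (inCodec n).len = d n := by
  simp only [inCodec, prod_len, zvec_len, pi_len, bitCodec_len, mul_one, d_eq]

/-- Repacking a candidate output and an extension bit into the next state: `(o, c) ↦ parse (code o ++ [c])`.
[cite: HaitnerEtAl2020, Lemma 5.7] -/
def pack (q : (G3v n × R3v n) × Bool) : Dv n := (zvec (N n)).dec (encOut3 n q.1 ++ [q.2])

/-- The code of a repacked state. [folklore] -/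
theorem enc_pack (q : (G3v n × R3v n) × Bool) : (zvec (N n)).enc (pack n q) = encOut3 n q.1 ++ [q.2] :=
  (zvec (N n)).enc_dec _ (by rw [List.length_append, length_encOut3, List.length_singleton, Nm1_add_one]; rfl)

/-- `pack` is injective. [cite: HaitnerEtAl2020, Lemma 5.7 (the chain is well defined)] -/
theorem pack_injective : Function.Injective (pack n) := by
  intro q q' h
  have h' := congrArg (zvec (N n)).enc h
  rw [enc_pack, enc_pack] at h'
  obtain ⟨h1, h2⟩ := List.append_inj h' (by rw [length_encOut3, length_encOut3])
  exact Prod.ext (encOut3_injective n h1) (List.singleton_inj.1 h2)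

/-- The basic family of component `j`: `G^{(j)}_y(st) = (cand n j f).fam y st`. [cite: HaitnerEtAl2020, proof of Thm. 5.1, Step 4] -/
noncomputable def famO (j : ℕ) (y st : Dv n) : G3v n × R3v n := (cand n j f).fam y st

/-- The chained component `j` on abstract data. [cite: HaitnerEtAl2020, Lemma 5.7] -/
noncomputable def chainAbs (j : ℕ) (yv : Fin (R n + 1) → Dv n) (inp : Dv n × (Fin (R n) → Bool)) : G3v n × R3v n :=
  chainOut (famO f n j) (pack n) (R n) yv inp

variable {f n}

/-- Reading a sub-block through an enclosing block. [folklore] -/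
theorem take_drop_block (L : List Bool) {a W b c : ℕ} (h : b + c ≤ W) :
    (((L.drop a).take W).drop b).take c = (L.drop (a + b)).take c := by
  rw [List.drop_take, List.take_take, List.drop_drop, min_eq_left (by omega)]

/-- **Keys on codes**: the string key of chain `j`, level `r` is the code of `keys j r`. [folklore] -/
theorem keyAt_enc (keys : Fin (Jp1 n) → Fin (R n + 1) → Dv n) (lo : List Bool) {j r : ℕ} (hj : j < Jp1 n) (hr : r < R n + 1) :
    keyAt n ((keysCodec n).enc keys ++ lo) j r = (zvec (N n)).enc (keys ⟨j, hj⟩ ⟨r, hr⟩) := by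
  have hK : ((keysCodec n).enc keys).length = K n := by rw [(keysCodec n).length_enc, keysCodec_len]
  have h1 : (j * (R n + 1) + r) * N n + N n ≤ K n := by
    have : (j * (R n + 1) + r) + 1 ≤ Jp1 n * (R n + 1) := by
      calc (j * (R n + 1) + r) + 1 ≤ j * (R n + 1) + (R n + 1) := by omega
        _ = (j + 1) * (R n + 1) := by ring
        _ ≤ Jp1 n * (R n + 1) := Nat.mul_le_mul_right _ hj
    calc (j * (R n + 1) + r) * N n + N n = ((j * (R n + 1) + r) + 1) * N n := by ring
      _ ≤ (Jp1 n * (R n + 1)) * N n := Nat.mul_le_mul_right _ this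
      _ = K n := by rw [K]
  have hin := pi_enc_block (zvec (N n)) (R n + 1) (keys ⟨j, hj⟩) ⟨r, hr⟩
  rw [zvec_len] at hin
  have hout := pi_enc_block ((zvec (N n)).pi (R n + 1)) (Jp1 n) keys ⟨j, hj⟩
  rw [pi_len, zvec_len] at hout
  rw [keyAt, take_drop_append_left (by rw [hK]; exact h1),
    show (j * (R n + 1) + r) * N n = j * ((R n + 1) * N n) + r * N n by ring,
    ← take_drop_block _ (show r * N n + N n ≤ (R n + 1) * N n by rw [← Nat.succ_mul]; exact Nat.mul_le_mul_right _ hr),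
    keysCodec, hout, hin]

variable (hf : IsLengthPreserving f)
include hf

/-- **The chain on codes**: the string state at level `r ≤ R` is the code of the abstract state.
[cite: HaitnerEtAl2020, Lemma 5.7] -/
theorem chainSt_enc (keys : Fin (Jp1 n) → Fin (R n + 1) → Dv n) (lo : List Bool) {j : ℕ} (hj : j < Jp1 n)
    (inp : Dv n × (Fin (R n) → Bool)) :
    ∀ {r : ℕ}, r ≤ R n → chainSt f n j ((keysCodec n).enc keys ++ lo) ((inCodec n).enc inp) r =
      (zvec (N n)).enc (chainState (famO f n j) (pack n) (R n) (keys ⟨j, hj⟩) inp.1 inp.2 r)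
  | 0, _ => by
    have hl : ((zvec (N n)).enc inp.1).length = N n := by rw [(zvec (N n)).length_enc, zvec_len]
    rw [chainSt, chainState, inCodec, prod_enc, List.take_left' hl]
  | r + 1, hr => by
    have hrR : r < R n := hr
    have hl : ((zvec (N n)).enc inp.1).length = N n := by rw [(zvec (N n)).length_enc, zvec_len]
    have hbit : (((inCodec n).enc inp).drop (N n + r)).take 1 = [inp.2 ⟨r, hrR⟩] := by
      have hb := pi_enc_block bitCodec (R n) inp.2 ⟨r, hrR⟩
      rw [bitCodec_len, mul_one, bitCodec_enc] at hb
      rw [inCodec, prod_enc, ← List.drop_drop, List.drop_left' hl, hb]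
    have hkey := keyAt_enc keys lo hj (Nat.lt_succ_of_lt hrR)
    have hS : chainState (famO f n j) (pack n) (R n) (keys ⟨j, hj⟩) inp.1 inp.2 (r + 1) =
        pack n ((cand n j f).fam (keys ⟨j, hj⟩ ⟨r, Nat.lt_succ_of_lt hrR⟩) (chainState (famO f n j) (pack n) (R n) (keys ⟨j, hj⟩) inp.1 inp.2 r),
          inp.2 ⟨r, hrR⟩) := by
      rw [chainState, dif_pos hrR]; rfl
    rw [chainSt, chainSt_enc keys lo hj inp hrR.le, hkey, hbit, zvec_enc, zvec_enc, candStr_enc hf, hS, enc_pack]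

/-- **The chain output on codes.** [cite: HaitnerEtAl2020, Lemma 5.7] -/
theorem chainOutStr_enc (keys : Fin (Jp1 n) → Fin (R n + 1) → Dv n) (lo : List Bool) {j : ℕ} (hj : j < Jp1 n)
    (inp : Dv n × (Fin (R n) → Bool)) :
    chainOutStr f n j ((keysCodec n).enc keys ++ lo) ((inCodec n).enc inp) = encOut3 n (chainAbs f n j (keys ⟨j, hj⟩) inp) := by
  rw [chainOutStr, chainSt_enc hf keys lo hj inp le_rfl, keyAt_enc keys lo hj (Nat.lt_succ_self _), zvec_enc, zvec_enc,
    candStr_enc hf, chainAbs, chainOut, famO]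

omit hf in
/-- Candidate outputs `(g₃, value)`, coded by `encOut3` (`N − 1` bits). [folklore] -/
def outCodec (n : ℕ) : BitCodec (G3v n × R3v n) := (BitCodec.vector (G3 n)).prod (zvec (r3 n))

omit hf in
/-- `(outCodec n).enc = encOut3 n`. [folklore] -/
@[simp] theorem outCodec_enc (q : G3v n × R3v n) : (outCodec n).enc q = encOut3 n q := rfl

/-- **The evaluator on codes is the coded concatenation of the chains.** [cite: HaitnerEtAl2020, proof of Thm. 5.1, Step 5] -/
theorem evalStr_enc (keys : Fin (Jp1 n) → Fin (R n + 1) → Dv n) (lo : List Bool) (inp : Dv n × (Fin (R n) → Bool)) :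
    evalStr f n ((keysCodec n).enc keys ++ lo) ((inCodec n).enc inp) =
      ((outCodec n).pi (Jp1 n)).enc (concatFam (fun j : Fin (Jp1 n) => chainAbs f n j) keys inp) := by
  rw [evalStr, pi_enc]
  refine ccat_congr fun j hj => ?_
  rw [dif_pos hj, outCodec_enc, concatFam, ← chainOutStr_enc hf keys lo hj inp]

end Model

/-! ### The abstract two-stage adversary of a string pair `(A₀, A)` -/

section Adversary

variable (f : List Bool → List Bool) (n qn lo κ : ℕ) (A₀ : List Bool → List Bool) (A : RandAlg (List Bool) (List Bool))

/-- The index string of keys and leftover index coins: `1ⁿ 0 (code keys ++ lo)`. [cite: HaitnerEtAl2020, proof of Thm. 5.1, Step 5] -/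
def indexStr (keys : Fin (Jp1 n) → Fin (R n + 1) → Dv n) (l : List Bool) : List Bool :=
  ones n ++ false :: ((keysCodec n).enc keys ++ l)

/-- The abstract target: the parse of `A₀(ρ)` (cut and padded to `d` bits — the identity on legitimate targets).
[cite: Goldreich2004, Def. 6.4.19 (3) (the algorithm `A₀`)] -/
def targetAbs (ρ : List.Vector Bool qn) : Dv n × (Fin (R n) → Bool) := (inCodec n).dec (fitLen (d n) (A₀ ρ.toList))

/-- The abstract second stage: the parse of `A(1ⁿ, s, ρ; ω)` on the index `s` of the keys and the leftover coins.
[cite: Goldreich2004, Def. 6.4.19 (3) (the algorithm `A`)] -/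
def advAbs (keys : Fin (Jp1 n) → Fin (R n + 1) → Dv n) (c : List.Vector Bool qn × List.Vector Bool lo) (ω : List.Vector Bool κ) :
    Dv n × (Fin (R n) → Bool) :=
  (inCodec n).dec (fitLen (d n) (A.run (boolPair (unaryEncodeNat n) (boolPair (indexStr n keys c.2.toList) c.1.toList)) ω.toList))

variable {f n qn lo κ A₀ A}

/-- **A restricted designated collision of the strings is an abstract designated collision of the concatenation**
(with distinct parsed points), for a length-preserving `f`. [cite: HaitnerEtAl2020, proof of Thm. 5.1, Step 5; Goldreich 2004, Def. 6.4.19] -/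
theorem collision_abs_of_str (hf : IsLengthPreserving f) {p : Polynomial ℕ} (hK : K n ≤ p.eval n)
    (keys : Fin (Jp1 n) → Fin (R n + 1) → Dv n) {l : List Bool} (hl : K n + l.length = p.eval n) {x₀ x : List Bool}
    (hx₀ : x₀.length = d n) (hx : x.length = d n)
    (hcoll : (family p f).hash (indexStr n keys l) x = (family p f).hash (indexStr n keys l) x₀) (hne : x ≠ x₀) :
    (inCodec n).dec x ≠ (inCodec n).dec x₀ ∧
      concatFam (fun j : Fin (Jp1 n) => chainAbs f n j) keys ((inCodec n).dec x) =
        concatFam (fun j : Fin (Jp1 n) => chainAbs f n j) keys ((inCodec n).dec x₀) := by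
  have hkb : ((keysCodec n).enc keys ++ l).length = p.eval n := by
    rw [List.length_append, (keysCodec n).length_enc, keysCodec_len, hl]
  have ex : (inCodec n).enc ((inCodec n).dec x) = x := (inCodec n).enc_dec x (by rw [hx, inCodec_len])
  have ex₀ : (inCodec n).enc ((inCodec n).dec x₀) = x₀ := (inCodec n).enc_dec x₀ (by rw [hx₀, inCodec_len])
  refine ⟨fun h => hne (by rw [← ex, ← ex₀, h]), ?_⟩
  rw [indexStr, family_hash_eq f hkb hK hx, family_hash_eq f hkb hK hx₀] at hcoll
  conv_lhs at hcoll => rw [← ex]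
  conv_rhs at hcoll => rw [← ex₀]
  rw [evalStr_enc hf, evalStr_enc hf] at hcoll
  exact ((outCodec n).pi (Jp1 n)).enc_injective hcoll

/-! ### The derived single-candidate adversary at grid index `j` and chain level `r` -/

variable (f n qn lo κ A₀ A)
variable (j : Fin (Jp1 n)) (r : Fin (R n + 1))

/-- Shared target coins of the planted adversaries: all keys, the target coins, the leftover index coins.
[cite: HaitnerEtAl2020, proof of Thm. 5.1, Step 5] -/
abbrev CoinsC := (Fin (Jp1 n) → Fin (R n + 1) → Dv n) × (List.Vector Bool qn × List.Vector Bool lo)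

/-- The target of the concatenation-planted adversary against chain `j`: the parse of `A₀(ρ)`.
[cite: HaitnerEtAl2020, proof of Thm. 5.1, Step 5 (iii)] -/
def targetJ (c : CoinsC n qn lo) : Dv n × (Fin (R n) → Bool) := targetAbs n qn A₀ c.2.1

/-- The second stage of the concatenation-planted adversary against chain `j`: plant the challenge key vector at
component `j` and run `A`. [cite: HaitnerEtAl2020, proof of Thm. 5.1, Step 5 (iii)] -/
def advJ (yv : Fin (R n + 1) → Dv n) (c : CoinsC n qn lo) (ω : List.Vector Bool κ) : Dv n × (Fin (R n) → Bool) :=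
  advAbs n qn lo κ A (Function.update c.1 j yv) c.2 ω

/-- Target coins of the level-planted adversary: an own chain-key vector and the shared coins.
[cite: HaitnerEtAl2020, Lemma 5.7] -/
abbrev CoinsJR := (Fin (R n + 1) → Dv n) × CoinsC n qn lo

/-- **The target of the single-candidate adversary at `(j, r)`**: the level-`r` chain state of the parsed `A₀(ρ)`
under the own key vector. [cite: HaitnerEtAl2020, Lemma 5.7 with Step 5] -/
noncomputable def targetJR (c : CoinsJR n qn lo) : Dv n :=
  chainState (famO f n j) (pack n) (R n) c.1 (targetJ n qn lo A₀ c.2).1 (targetJ n qn lo A₀ c.2).2 r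

/-- **The second stage of the single-candidate adversary at `(j, r)`**: plant the challenge key `y` at level `r` of
the own key vector, plant that vector at component `j`, run `A`, and return the level-`r` state of its parsed answer.
[cite: HaitnerEtAl2020, Lemma 5.7 with Step 5] -/
noncomputable def advJR (y : Dv n) (c : CoinsJR n qn lo) (ω : List.Vector Bool κ) : Dv n :=
  chainState (famO f n j) (pack n) (R n) (Function.update c.1 r y)
    (advJ n qn lo κ A j (Function.update c.1 r y) c.2 ω).1 (advJ n qn lo κ A j (Function.update c.1 r y) c.2 ω).2 r

/-- Coins of the finder fed to the inverter: planted coordinate, tuple, hash keys, and the above.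
[cite: HaitnerEtAl2020, Claim 4.6 with Lemmas 5.3–5.6] -/
abbrev CoinsA0 := Fin (t n) × Wv n × (G2v n × (G3v n × (CoinsJR n qn lo × List.Vector Bool κ)))

/-- **The check-free finder** computed by the inverting machine: plant `(x, κ, i)` at coordinate `j₁` of `w`,
form the `F₃`-input `v = ((w', g₂), g₃)`, shift by the target, run the derived adversary, unshift, and read the
first component of coordinate `j₁`. [cite: HaitnerEtAl2020, Claim 4.6 with Lemmas 5.3 (ii), 5.4 (ii), 5.5, 5.6] -/
noncomputable def rawA0 (x : Xv n) (κv : Kv n) (i : Fin (M n)) (c : CoinsA0 n qn lo κ) : Xv n :=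
  let C := cand n j f
  let v : (Wv n × G2v n) × G3v n := ((Function.update c.2.1 c.1 (x, κv, i), c.2.2.1), c.2.2.2.1)
  let yk : Dv n := C.e.symm v - targetJR f n qn lo A₀ j r c.2.2.2.2.1
  ((C.e (yk + advJR f n qn lo κ A j r yk c.2.2.2.2.1 c.2.2.2.2.2)).1.1 c.1).1

/-- **The finder `advA0` of the combinatorial analysis returns either the planted `x` or the check-free answer.**
[cite: HaitnerEtAl2020, Claim 4.6 with Lemmas 5.3–5.6] -/
theorem advA0_eq_or (x : Xv n) (κv : Kv n) (i : Fin (M n)) (c : CoinsA0 n qn lo κ) :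
    (cand n j f).advA0 (targetJR f n qn lo A₀ j r) (advJR f n qn lo κ A j r) x κv i c = x ∨
      (cand n j f).advA0 (targetJR f n qn lo A₀ j r) (advJR f n qn lo κ A j r) x κv i c = rawA0 f n qn lo κ A₀ A j r x κv i c := by
  rcases c with ⟨j₁, w, g₂, g₃, c', ω⟩
  simp only [CandData.advA0, firstFinder, dif_pos i.isLt, Fin.eta, CandData.advB0, coordAdv, CandData.advB1, CandData.advA4,
    CandData.advB2, sibFinder, CandData.advA5, CandData.advB3, shiftFinder, rawA0]
  split_ifs
  · right; rfl
  all_goals left; simp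

end Adversary

end HHRVW

end Literature.Computability.Cryptography
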